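import Literature.Geometry.Riemannian.MCFComparisonPrinciple
import Literature.Analysis.Calculus.MixedPartials
import Literature.Analysis.Calculus.JacobiFormula
import Literature.Geometry.Lorentzian.InverseMeanCurvatureFlowArea
import HarnessLib

/-!
# Evolution of the induced metric under mean curvature flow: `∂ₜ g = -2 H K`

Topic `Literature/Geometry/Riemannian`. For a classical mean curvature flow `(F, ν)` of `ℝⁿ⁺¹`
(`IsClassicalMCF` of `MeanConvexLevelSetFlow.lean`, `∂ₜF = -H ν`) on `[a, b]`, `t₀ ∈ [a, b]`,
`p ∈ N` and `u, w ∈ T_p N`, the induced metric `g_t = F_t^* δ` satisfies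

* `IsClassicalMCF.hasDerivAt_inducedBilin_self` — `d/dt|_{t₀} g_t(u, u) = -2 H(t₀, p) K_{t₀}(u, u)`;
* `IsClassicalMCF.hasDerivAt_inducedBilin` — `d/dt|_{t₀} g_t(u, w) = -H (K(u, w) + K(w, u))`
  (`= -2 H K(u, w)`, `K` being symmetric),

Huisken's `∂ₜ g_{ij} = -2 H h_{ij}` (1984, Lemma 3.2). Proof WITHOUT differentiating `H`: along the
variation `Φ(t, s) = F(t, c_u(s))` through the chart-straight curve `c_u` (`contDiffAt_variation`,
joint smoothness), `dF_t u = ∂ₛΦ(t, 0)`, its `t`-derivative is the mixed derivative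
`∂ₜ∂ₛΦ = ∂ₛ∂ₜΦ` (`MixedPartials.lean`), and differentiating the orthogonality
`⟪∂ₜΦ(t₀, s), ∂ₛΦ(t₀, s)⟫ = 0` (`∂ₜΦ = -Hν` normal, `∂ₛΦ = dF(c') ` tangent) at `s = 0` gives
`⟪∂ₛ∂ₜΦ, dF u⟫ = H ⟪ν, (F_{t₀} ∘ c_u)''(0)⟫ = -H K(u, u)` (`secondFundamentalForm_self_eq_neg_inner`,
`EuclideanHypersurfaceContact.lean`);

* `IsClassicalMCF.hasDerivAt_sqrt_det_gram` — **the area element decays by `H²`**: for a basis `β`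
  of `T_p N`, `d/dt|_{t₀} √det (g_t(βᵢ, βⱼ)) = -H(t₀, p)² √det (g_{t₀}(βᵢ, βⱼ))` (Huisken's
  `∂ₜ μ_t = -H² μ_t`), from Jacobi's formula (`JacobiFormula.lean`), the symmetry of the inverse Gram
  matrix and the trace formula `H = tr_g K = Σ K_{im} (G⁻¹)_{mi}` (`trace_eq_sum_mul_inv_gram`,
  `InverseMeanCurvatureFlowArea.lean`). This is the pointwise input for `d/dt Area(M_t) = -∫ H²`
  and for Huisken's monotonicity formula.

Everything is PROVED; no definitions, no named facts.

## References

* G. Huisken, *Flow by mean curvature of convex surfaces into spheres*, J. Differential Geom. 20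
  (1984) 237–266, Lemma 3.2 (`∂ₜ g_{ij} = -2H h_{ij}`) and the evolution of the measure
  `∂ₜ μ_t = -H² μ_t`. [Huisken1984]
* C. Mantegazza, *Lecture Notes on Mean Curvature Flow*, Birkhäuser 2011, Prop. 2.3.1 and
  Prop. 2.3.3. [Mantegazza2011]
-/


noncomputable section

open Bundle Set Function Metric Module Filter
open scoped Manifold ContDiff Topology RealInnerProductSpace Matrix

namespace Literature.Geometry.Riemannian

open Lorentzian Lorentzian.PseudoRiemannianMetric EuclideanHypersurface Literature.Analysis.Calculus

section Variation

variable {n : ℕ} {N : Type*} [TopologicalSpace N] [ChartedSpace (EuclideanSpace ℝ (Fin n)) N]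
  [IsManifold (𝓡 n) ∞ N] {F : ℝ → N → EuclideanSpace ℝ (Fin (n + 1))} {U : Set ℝ}

omit [IsManifold (𝓡 n) ∞ N] in
/-- Space slices of a jointly smooth family are smooth. [folklore] -/
theorem contMDiff_spaceSlice_of_contMDiffOn (hF : ContMDiffOn (𝓘(ℝ, ℝ).prod (𝓡 n)) 𝓘(ℝ, EuclideanSpace ℝ (Fin (n + 1))) ∞
      (fun p : ℝ × N ↦ F p.1 p.2) (U ×ˢ univ)) {t : ℝ} (ht : t ∈ U) :
    ContMDiff (𝓡 n) 𝓘(ℝ, EuclideanSpace ℝ (Fin (n + 1))) ∞ (F t) :=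
  hF.comp_contMDiff (f := fun y : N ↦ (t, y)) (contMDiff_const.prodMk contMDiff_id)
    fun _ ↦ ⟨ht, mem_univ _⟩

/-- **The variation `Φ(t, s) = F(t, c(s))` along a chart-straight curve is jointly `C^∞`** at
`(t₀, s)` whenever `t₀ ∈ U` and the chart point of `c(s)` lies in the chart target. [folklore] -/
theorem contDiffAt_variation (hU : IsOpen U)
    (hF : ContMDiffOn (𝓘(ℝ, ℝ).prod (𝓡 n)) 𝓘(ℝ, EuclideanSpace ℝ (Fin (n + 1))) ∞
      (fun p : ℝ × N ↦ F p.1 p.2) (U ×ˢ univ)) {t₀ : ℝ} (ht₀ : t₀ ∈ U) (p : N)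
    (u : TangentSpace (𝓡 n) p) {s : ℝ}
    (hs : extChartAt (𝓡 n) p p + s • (show EuclideanSpace ℝ (Fin n) from u) ∈ (extChartAt (𝓡 n) p).target) :
    ContDiffAt ℝ ∞ (fun q : ℝ × ℝ ↦ F q.1 (curveThrough (𝓡 n) p u q.2)) (t₀, s) := by
  have h1 : ContMDiffAt (𝓘(ℝ, ℝ).prod (𝓡 n)) 𝓘(ℝ, EuclideanSpace ℝ (Fin (n + 1))) ∞
      (fun q : ℝ × N ↦ F q.1 q.2) (t₀, curveThrough (𝓡 n) p u s) :=
    hF.contMDiffAt ((hU.prod isOpen_univ).mem_nhds ⟨ht₀, mem_univ _⟩)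
  -- source `ℝ × ℝ` with the model `𝓘(ℝ, ℝ × ℝ)` so that `ContMDiffAt.contDiffAt` applies
  have hsnd : ContMDiffAt 𝓘(ℝ, ℝ × ℝ) 𝓘(ℝ, ℝ) ∞ (Prod.snd : ℝ × ℝ → ℝ) (t₀, s) :=
    contDiff_snd.contMDiff.contMDiffAt
  have hfst : ContMDiffAt 𝓘(ℝ, ℝ × ℝ) 𝓘(ℝ, ℝ) ∞ (Prod.fst : ℝ × ℝ → ℝ) (t₀, s) :=
    contDiff_fst.contMDiff.contMDiffAt
  have hc : ContMDiffAt 𝓘(ℝ, ℝ × ℝ) (𝓡 n) ∞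
      (fun q : ℝ × ℝ ↦ curveThrough (𝓡 n) p u q.2) (t₀, s) :=
    ContMDiffAt.comp (t₀, s) (g := curveThrough (𝓡 n) p u) (f := (Prod.snd : ℝ × ℝ → ℝ))
      (EuclideanHypersurface.contMDiffAt_curveThrough p u hs) hsnd
  have h2 : ContMDiffAt 𝓘(ℝ, ℝ × ℝ) (𝓘(ℝ, ℝ).prod (𝓡 n)) ∞
      (fun q : ℝ × ℝ ↦ (q.1, curveThrough (𝓡 n) p u q.2)) (t₀, s) :=
    hfst.prodMk hc
  exact (h1.comp (t₀, s) h2).contDiffAt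

end Variation

section MetricEvolution

variable {n : ℕ} {N : Type*} [TopologicalSpace N] [ChartedSpace (EuclideanSpace ℝ (Fin n)) N]
  [IsManifold (𝓡 n) ∞ N] {F : ℝ → N → EuclideanSpace ℝ (Fin (n + 1))}
  {ν : (t : ℝ) → NormalField (𝓡 (n + 1)) (F t)} {a b : ℝ}

/-- **Evolution of the induced metric under mean curvature flow, diagonal form**: for a classical
mean curvature flow `(F, ν)` of `ℝⁿ⁺¹` on `[a, b]`, `t₀ ∈ [a, b]`, `p ∈ N`, `u ∈ T_p N`,

  `d/dt|_{t₀} (F_t^*δ)_p(u, u) = d/dt ‖d(F_t)_p u‖² = -2 H(t₀, p) K_{t₀}(u, u)`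

(`∂ₜ g_{ij} = -2 H A_{ij}`; Huisken 1984, Lemma 3.2; Mantegazza 2011, Prop. 2.3.1). Proof: with the
variation `Φ(t, s) = F(t, c_u(s))` along the chart-straight curve of velocity `u`,
`d(F_t)_p u = ∂ₛΦ(t, 0)` and its `t`-derivative is the mixed derivative `∂ₜ∂ₛΦ = ∂ₛ∂ₜΦ`
(`MixedPartials.lean`); differentiating the orthogonality `⟪∂ₜΦ(t₀, s), ∂ₛΦ(t₀, s)⟫ = 0`
(`∂ₜΦ = -Hν` is normal, `∂ₛΦ` tangent) at `s = 0` gives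
`⟪∂ₛ∂ₜΦ, dF u⟫ = H ⟪ν, (F_{t₀} ∘ c_u)''(0)⟫ = -H K(u, u)`
(`secondFundamentalForm_self_eq_neg_inner`); no regularity of `H` is used.
[cite: Huisken1984, Lemma 3.2] [cite: Mantegazza2011, Prop. 2.3.1] -/
theorem IsClassicalMCF.hasDerivAt_inducedBilin_self
    (h : IsClassicalMCF (euclideanMetric (EuclideanSpace ℝ (Fin (n + 1)))) F ν a b) {t₀ : ℝ}
    (ht₀ : t₀ ∈ Icc a b) (p : N) (u : TangentSpace (𝓡 n) p) :
    HasDerivAt (fun t ↦ (euclideanMetric (EuclideanSpace ℝ (Fin (n + 1)))).inducedBilin (𝓡 n) (F t) p u u)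
      (-2 * (euclideanMetric _).meanCurvature (F t₀) contMDiff_pullbackBilin_holds
          (h.isSpacelikeImmersion t₀ ht₀) (ν t₀) p *
        (euclideanMetric _).secondFundamentalForm (𝓡 n) (F t₀) (ν t₀) p u u) t₀ := by
  obtain ⟨U, hU, hIU, hF⟩ := h.contMDiffOn
  have ht₀U : t₀ ∈ U := hIU ht₀
  have hsl : ∀ t ∈ U, ContMDiff (𝓡 n) 𝓘(ℝ, EuclideanSpace ℝ (Fin (n + 1))) ∞ (F t) :=
    fun t ht ↦ contMDiff_spaceSlice_of_contMDiffOn hF ht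
  have hνs : ContMDiff (𝓡 n) 𝓘(ℝ, EuclideanSpace ℝ (Fin (n + 1))) ∞ (ν t₀) :=
    (contMDiff_of_contMDiff_lift (h.contMDiff_normal t₀ ht₀)).2
  -- the variation and its joint smoothness at `(t₀, 0)`
  set Φ : ℝ × ℝ → EuclideanSpace ℝ (Fin (n + 1)) := fun q ↦ F q.1 (curveThrough (𝓡 n) p u q.2)
    with hΦdef
  have hs0 : extChartAt (𝓡 n) p p + (0 : ℝ) • (show EuclideanSpace ℝ (Fin n) from u) ∈
      (extChartAt (𝓡 n) p).target := by
    rw [zero_smul, add_zero]; exact mem_extChartAt_target p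
  have hΦ : ContDiffAt ℝ 2 Φ (t₀, 0) := (contDiffAt_variation hU hF ht₀U p u hs0).of_le (by norm_cast)
  set X : EuclideanSpace ℝ (Fin (n + 1)) :=
    fderiv ℝ (fderiv ℝ Φ) (t₀, 0) ((1 : ℝ), (0 : ℝ)) ((0 : ℝ), (1 : ℝ)) with hX
  -- (1) `t ↦ d(F_t)_p u` has derivative `X` at `t₀`
  have hX1 := hasDerivAt_deriv_curry_right_mixed hΦ
  have heq : (fun t ↦ deriv (fun s ↦ Φ (t, s)) 0) =ᶠ[𝓝 t₀] fun t ↦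
      (mfderiv (𝓡 n) 𝓘(ℝ, EuclideanSpace ℝ (Fin (n + 1))) (F t) p :
        TangentSpace (𝓡 n) p →L[ℝ] EuclideanSpace ℝ (Fin (n + 1))) u := by
    filter_upwards [hU.mem_nhds ht₀U] with t ht
    exact (hasDerivAt_comp_curveThrough_zero (hsl t ht) p u).deriv
  have hdF : HasDerivAt (fun t ↦ (mfderiv (𝓡 n) 𝓘(ℝ, EuclideanSpace ℝ (Fin (n + 1))) (F t) p :
      TangentSpace (𝓡 n) p →L[ℝ] EuclideanSpace ℝ (Fin (n + 1))) u) X t₀ :=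
    hX1.congr_of_eventuallyEq heq.symm
  -- (2) `s ↦ ∂ₜΦ(t₀, s)` has derivative `X` at `0`
  have hX2 : HasDerivAt (fun s ↦ deriv (fun t ↦ Φ (t, s)) t₀) X 0 :=
    hasDerivAt_deriv_curry_left_mixed hΦ
  -- the velocity along the curve: `∂ₜΦ(t₀, s) = -H(c s) ν(c s)`
  set Hf : N → ℝ := fun y ↦ (euclideanMetric _).meanCurvature (F t₀) contMDiff_pullbackBilin_holds
    (h.isSpacelikeImmersion t₀ ht₀) (ν t₀) y with hHf
  set w : ℝ → EuclideanSpace ℝ (Fin (n + 1)) := fun s ↦ ν t₀ (curveThrough (𝓡 n) p u s) with hw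
  have hvel : ∀ s, deriv (fun t ↦ Φ (t, s)) t₀ = (-(Hf (curveThrough (𝓡 n) p u s))) • w s := by
    intro s
    simp only [hΦdef]
    rw [← mfderiv_slice_apply_one]
    exact h.velocity_eq t₀ ht₀ _
  -- (3) orthogonality `⟪∂ₜΦ(t₀, s), ∂ₛΦ(t₀, s)⟫ = 0` near `s = 0`
  have horth : (fun s ↦ ⟪deriv (fun t ↦ Φ (t, s)) t₀, deriv (fun s' ↦ Φ (t₀, s')) s⟫) =ᶠ[𝓝 0]
      fun _ ↦ (0 : ℝ) := by
    filter_upwards [eventually_lineThrough_mem_target p u] with s hs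
    rw [hvel s]
    have hd := (hasDerivAt_comp_curveThrough (hsl t₀ ht₀U) p u hs).deriv
    have hn : ⟪w s, (mfderiv (𝓡 n) 𝓘(ℝ, EuclideanSpace ℝ (Fin (n + 1))) (F t₀)
        (curveThrough (𝓡 n) p u s) : TangentSpace (𝓡 n) _ →L[ℝ] EuclideanSpace ℝ (Fin (n + 1)))
        (velocity (𝓡 n) (curveThrough (𝓡 n) p u) s)⟫ = 0 :=
      (h.isUnitNormal t₀ ht₀).isNormalTo _ _
    have hd' : deriv (fun s' ↦ Φ (t₀, s')) s = (mfderiv (𝓡 n) 𝓘(ℝ, EuclideanSpace ℝ (Fin (n + 1)))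
        (F t₀) (curveThrough (𝓡 n) p u s) :
          TangentSpace (𝓡 n) _ →L[ℝ] EuclideanSpace ℝ (Fin (n + 1)))
        (velocity (𝓡 n) (curveThrough (𝓡 n) p u) s) := hd
    rw [hd', real_inner_smul_left, hn, mul_zero]
  -- (4) differentiate the orthogonality at `s = 0`
  have hβ0 : ContDiffAt ℝ ∞ (fun s' ↦ Φ (t₀, s')) 0 :=
    (eventually_contDiffAt_comp_curveThrough (hsl t₀ ht₀U) p u).self_of_nhds
  have hβ2 := hasDerivAt_deriv_of_contDiffAt hβ0
  have hprod := hX2.inner ℝ hβ2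
  have hzero : deriv (fun s ↦ ⟪deriv (fun t ↦ Φ (t, s)) t₀, deriv (fun s' ↦ Φ (t₀, s')) s⟫) 0 = 0 := by
    rw [horth.deriv_eq, deriv_const]
  rw [hprod.deriv] at hzero
  -- `hzero : ⟪∂ₜΦ(t₀,0), β''(0)⟫ + ⟪X, β'(0)⟫ = 0`
  have hβ1 : deriv (fun s' ↦ Φ (t₀, s')) 0 =
      (mfderiv (𝓡 n) 𝓘(ℝ, EuclideanSpace ℝ (Fin (n + 1))) (F t₀) p :
        TangentSpace (𝓡 n) p →L[ℝ] EuclideanSpace ℝ (Fin (n + 1))) u :=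
    (hasDerivAt_comp_curveThrough_zero (hsl t₀ ht₀U) p u).deriv
  have hK : (euclideanMetric _).secondFundamentalForm (𝓡 n) (F t₀) (ν t₀) p u u =
      -⟪ν t₀ p, deriv (deriv (fun s' ↦ Φ (t₀, s'))) 0⟫ :=
    secondFundamentalForm_self_eq_neg_inner (hsl t₀ ht₀U) hνs (h.isUnitNormal t₀ ht₀).isNormalTo p u
  have hv0 : deriv (fun t ↦ Φ (t, 0)) t₀ = (-(Hf p)) • w 0 := by
    rw [hvel 0, curveThrough_zero]
  have hw0 : w 0 = ν t₀ p := by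
    show ν t₀ (curveThrough (𝓡 n) p u 0) = ν t₀ p
    rw [curveThrough_zero]
  rw [← hw0] at hK
  rw [hv0, hβ1, real_inner_smul_left] at hzero
  -- (5) the derivative of `g_t(u, u) = ⟪dF_t u, dF_t u⟫`
  have hXu : ⟪X, (mfderiv (𝓡 n) 𝓘(ℝ, EuclideanSpace ℝ (Fin (n + 1))) (F t₀) p :
      TangentSpace (𝓡 n) p →L[ℝ] EuclideanSpace ℝ (Fin (n + 1))) u⟫ =
      -(Hf p) * (euclideanMetric _).secondFundamentalForm (𝓡 n) (F t₀) (ν t₀) p u u := by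
    have hK' : (euclideanMetric _).secondFundamentalForm (𝓡 n) (F t₀) (ν t₀) p u u =
        -⟪w 0, deriv (deriv fun s' ↦ Φ (t₀, s')) 0⟫ := hK
    rw [hK']
    linarith [hzero]
  have hfun : (fun t ↦ (euclideanMetric (EuclideanSpace ℝ (Fin (n + 1)))).inducedBilin (𝓡 n) (F t) p u u) =
      fun t ↦ ⟪(mfderiv (𝓡 n) 𝓘(ℝ, EuclideanSpace ℝ (Fin (n + 1))) (F t) p :
        TangentSpace (𝓡 n) p →L[ℝ] EuclideanSpace ℝ (Fin (n + 1))) u,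
        (mfderiv (𝓡 n) 𝓘(ℝ, EuclideanSpace ℝ (Fin (n + 1))) (F t) p :
        TangentSpace (𝓡 n) p →L[ℝ] EuclideanSpace ℝ (Fin (n + 1))) u⟫ := by
    funext t
    rw [inducedBilin_apply, euclideanMetric_apply]
  rw [hfun]
  refine (hdF.inner ℝ hdF).congr_deriv ?_
  have hXu' := (real_inner_comm X ((mfderiv (𝓡 n) 𝓘(ℝ, EuclideanSpace ℝ (Fin (n + 1))) (F t₀) p :
      TangentSpace (𝓡 n) p →L[ℝ] EuclideanSpace ℝ (Fin (n + 1))) u)).trans hXu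
  rw [hXu', hXu]
  simp only [hHf]
  ring


/-- **Evolution of the induced metric under mean curvature flow**:
`d/dt|_{t₀} (F_t^*δ)_p(u, w) = -H(t₀, p) (K_{t₀}(u, w) + K_{t₀}(w, u))` (`= -2 H K(u, w)` by the
symmetry of `K`) — polarisation of `hasDerivAt_inducedBilin_self`.
[cite: Huisken1984, Lemma 3.2] [cite: Mantegazza2011, Prop. 2.3.1] -/
theorem IsClassicalMCF.hasDerivAt_inducedBilin
    (h : IsClassicalMCF (euclideanMetric (EuclideanSpace ℝ (Fin (n + 1)))) F ν a b) {t₀ : ℝ}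
    (ht₀ : t₀ ∈ Icc a b) (p : N) (u w : TangentSpace (𝓡 n) p) :
    HasDerivAt (fun t ↦ (euclideanMetric (EuclideanSpace ℝ (Fin (n + 1)))).inducedBilin (𝓡 n) (F t) p u w)
      (-(euclideanMetric _).meanCurvature (F t₀) contMDiff_pullbackBilin_holds
          (h.isSpacelikeImmersion t₀ ht₀) (ν t₀) p *
        ((euclideanMetric _).secondFundamentalForm (𝓡 n) (F t₀) (ν t₀) p u w +
          (euclideanMetric _).secondFundamentalForm (𝓡 n) (F t₀) (ν t₀) p w u)) t₀ := by
  set B : ℝ → (TangentSpace (𝓡 n) p →L[ℝ] TangentSpace (𝓡 n) p →L[ℝ] ℝ) := fun t ↦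
    (euclideanMetric (EuclideanSpace ℝ (Fin (n + 1)))).inducedBilin (𝓡 n) (F t) p with hB
  set K := (euclideanMetric (EuclideanSpace ℝ (Fin (n + 1)))).secondFundamentalForm (𝓡 n) (F t₀)
    (ν t₀) p with hKdef
  set H := (euclideanMetric (EuclideanSpace ℝ (Fin (n + 1)))).meanCurvature (F t₀)
    contMDiff_pullbackBilin_holds (h.isSpacelikeImmersion t₀ ht₀) (ν t₀) p with hH
  -- symmetry and polarisation of the induced form
  have hsymm : ∀ t, B t u w = B t w u := fun t ↦ by
    simp only [hB]
    rw [inducedBilin_apply, inducedBilin_apply, euclideanMetric_apply, euclideanMetric_apply]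
    exact real_inner_comm _ _
  have hpol : (fun t ↦ B t u w) = fun t ↦
      (1 / 2 : ℝ) * (B t (u + w) (u + w) - B t u u - B t w w) := by
    funext t
    simp only [map_add, FunLike.coe_add, Pi.add_apply, ← hsymm t]
    ring
  have h1 := h.hasDerivAt_inducedBilin_self ht₀ p (u + w)
  have h2 := h.hasDerivAt_inducedBilin_self ht₀ p u
  have h3 := h.hasDerivAt_inducedBilin_self ht₀ p w
  have hKpol : K (u + w) (u + w) = K u u + K u w + K w u + K w w := by
    simp only [map_add, LinearMap.add_apply]
    ring
  have hgoal : (fun t ↦ (euclideanMetric (EuclideanSpace ℝ (Fin (n + 1)))).inducedBilin (𝓡 n) (F t) p u w) =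
      fun t ↦ B t u w := rfl
  rw [hgoal, hpol]
  refine (((h1.sub h2).sub h3).const_mul (1 / 2 : ℝ)).congr_deriv ?_
  simp only [← hKdef, ← hH]
  rw [hKpol]
  ring

end MetricEvolution

/-! ### The area element: `∂ₜ √det g = -H² √det g` -/

section AreaElement

variable {n : ℕ} {N : Type*} [TopologicalSpace N] [ChartedSpace (EuclideanSpace ℝ (Fin n)) N]
  [IsManifold (𝓡 n) ∞ N] {F : ℝ → N → EuclideanSpace ℝ (Fin (n + 1))}
  {ν : (t : ℝ) → NormalField (𝓡 (n + 1)) (F t)} {a b : ℝ}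

/-- **Evolution of the area element under mean curvature flow**: for a basis `β` of `T_p N`, the
Gram determinant `D(t) = det (g_t(βᵢ, βⱼ))` of the induced metrics satisfies
`d/dt|_{t₀} √D = -H(t₀, p)² √D(t₀)` — Huisken's `∂ₜ μ_t = -H² μ_t` (1984, Lemma 3.2 / Cor. 3.6;
Mantegazza 2011, Prop. 2.3.3). Proof: `∂ₜ g_{ij} = -H (K_{ij} + K_{ji})`
(`hasDerivAt_inducedBilin`), Jacobi's formula `(√det G)' = ½ √det G · tr (G⁻¹ G')`
(`JacobiFormula.lean`), symmetry of `G⁻¹` and the trace formula `H = tr_g K = Σ K_{im} (G⁻¹)_{mi}`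
(`trace_eq_sum_mul_inv_gram`). [cite: Huisken1984, Lemma 3.2] [cite: Mantegazza2011, Prop. 2.3.3] -/
theorem IsClassicalMCF.hasDerivAt_sqrt_det_gram
    (h : IsClassicalMCF (euclideanMetric (EuclideanSpace ℝ (Fin (n + 1)))) F ν a b) {t₀ : ℝ}
    (ht₀ : t₀ ∈ Icc a b) (p : N) {ι : Type*} [Fintype ι] [DecidableEq ι]
    (β : Module.Basis ι ℝ (TangentSpace (𝓡 n) p)) :
    HasDerivAt (fun t ↦ Real.sqrt (Matrix.of fun i j ↦
        (euclideanMetric (EuclideanSpace ℝ (Fin (n + 1)))).inducedBilin (𝓡 n) (F t) p (β i) (β j)).det)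
      (-((euclideanMetric _).meanCurvature (F t₀) contMDiff_pullbackBilin_holds
          (h.isSpacelikeImmersion t₀ ht₀) (ν t₀) p) ^ 2 *
        Real.sqrt (Matrix.of fun i j ↦
          (euclideanMetric (EuclideanSpace ℝ (Fin (n + 1)))).inducedBilin (𝓡 n) (F t₀) p (β i) (β j)).det)
      t₀ := by
  set g₁ := (euclideanMetric (EuclideanSpace ℝ (Fin (n + 1)))).inducedMetric (F t₀)
    contMDiff_pullbackBilin_holds (h.isSpacelikeImmersion t₀ ht₀) with hg₁
  set K := (euclideanMetric (EuclideanSpace ℝ (Fin (n + 1)))).secondFundamentalForm (𝓡 n) (F t₀)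
    (ν t₀) p with hKdef
  set H := (euclideanMetric (EuclideanSpace ℝ (Fin (n + 1)))).meanCurvature (F t₀)
    contMDiff_pullbackBilin_holds (h.isSpacelikeImmersion t₀ ht₀) (ν t₀) p with hH
  -- the Gram curve and its derivative
  set A : ℝ → ι → ι → ℝ := fun t i j ↦
    (euclideanMetric (EuclideanSpace ℝ (Fin (n + 1)))).inducedBilin (𝓡 n) (F t) p (β i) (β j) with hA
  set A' : ι → ι → ℝ := fun i j ↦ -H * (K (β i) (β j) + K (β j) (β i)) with hA'
  have hAd : HasDerivAt A A' t₀ :=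
    hasDerivAt_pi.2 fun i ↦ hasDerivAt_pi.2 fun j ↦ h.hasDerivAt_inducedBilin ht₀ p (β i) (β j)
  -- the Gram matrix at `t₀` is that of the Riemannian metric `g₁`
  have hΓ : Matrix.of (A t₀) = Matrix.of fun i j ↦ g₁.val p (β i) (β j) := by
    ext i j
    rw [Matrix.of_apply, Matrix.of_apply, hg₁, inducedMetric_val]
  have hpos : 0 < (Matrix.of (A t₀)).det := by
    rw [hΓ]
    have hmat : (Matrix.of fun i j ↦ (g₁.toBilinForm p) (β i) (β j)) =
        Matrix.of fun i j ↦ g₁.val p (β i) (β j) := by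
      ext i j; rw [Matrix.of_apply, Matrix.of_apply, toBilinForm_apply]
    rw [← hmat]
    refine det_gram_pos β (g₁.toBilinForm p) (fun v w ↦ ?_) (fun v hv ↦ ?_)
    · rw [toBilinForm_apply, toBilinForm_apply]; exact g₁.symm p v w
    · rw [toBilinForm_apply]; exact isRiemannian_inducedMetric _ _ _ _ p v hv
  -- Jacobi
  have hJ := hasDerivAt_sqrt_det (A' := (Matrix.of A' : Matrix ι ι ℝ)) hAd hpos
  -- the trace: `tr (Γ⁻¹ A') = -2 H · tr_g K = -2 H²`
  have htrK : H = ∑ i, ∑ m, K (β i) (β m) * (Matrix.of (A t₀))⁻¹ m i := by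
    rw [hΓ, hH, meanCurvature]
    exact g₁.trace_eq_sum_mul_inv_gram p β K
  have hΓsymm : (Matrix.of (A t₀))ᵀ = Matrix.of (A t₀) := by
    ext i j
    simp only [Matrix.transpose_apply, Matrix.of_apply, hA]
    rw [inducedBilin_apply, inducedBilin_apply, euclideanMetric_apply, euclideanMetric_apply]
    exact real_inner_comm _ _
  have hinvsymm : ∀ i m, (Matrix.of (A t₀))⁻¹ i m = (Matrix.of (A t₀))⁻¹ m i := fun i m ↦ by
    have h1 : (Matrix.of (A t₀))⁻¹ i m = ((Matrix.of (A t₀))⁻¹)ᵀ m i := rfl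
    rw [h1, Matrix.transpose_nonsing_inv, hΓsymm]
  have htr : ((Matrix.of (A t₀))⁻¹ * Matrix.of A').trace = -2 * H ^ 2 := by
    have h1 : ((Matrix.of (A t₀))⁻¹ * Matrix.of A').trace =
        ∑ i, ∑ m, (Matrix.of (A t₀))⁻¹ i m * (-H * (K (β m) (β i) + K (β i) (β m))) := by
      simp only [Matrix.trace, Matrix.diag_apply, Matrix.mul_apply, Matrix.of_apply, hA']
    have h2 : ∑ i, ∑ m, (Matrix.of (A t₀))⁻¹ i m * K (β m) (β i) =
        ∑ i, ∑ m, K (β i) (β m) * (Matrix.of (A t₀))⁻¹ m i := by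
      rw [Finset.sum_comm]
      exact Finset.sum_congr rfl fun i _ ↦ Finset.sum_congr rfl fun m _ ↦ mul_comm _ _
    have h3 : ∑ i, ∑ m, (Matrix.of (A t₀))⁻¹ i m * K (β i) (β m) =
        ∑ i, ∑ m, K (β i) (β m) * (Matrix.of (A t₀))⁻¹ m i :=
      Finset.sum_congr rfl fun i _ ↦ Finset.sum_congr rfl fun m _ ↦ by rw [hinvsymm i m, mul_comm]
    have h4 : ∑ i, ∑ m, (Matrix.of (A t₀))⁻¹ i m * (-H * (K (β m) (β i) + K (β i) (β m))) =
        -H * (∑ i, ∑ m, (Matrix.of (A t₀))⁻¹ i m * K (β m) (β i) +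
          ∑ i, ∑ m, (Matrix.of (A t₀))⁻¹ i m * K (β i) (β m)) := by
      rw [← Finset.sum_add_distrib, Finset.mul_sum]
      refine Finset.sum_congr rfl fun i _ ↦ ?_
      rw [← Finset.sum_add_distrib, Finset.mul_sum]
      exact Finset.sum_congr rfl fun m _ ↦ by ring
    rw [h1, h4, h2, h3, ← htrK]
    ring
  refine hJ.congr_deriv ?_
  rw [htr]
  simp only [hA]
  ring

end AreaElement

end Literature.Geometry.Riemannian

end
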